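import Mathlib
import Summits.Ventures.HodgeRepro2.A2GaloisKernel

/-!
# A2GaloisKernelInstance — the semilinear Galois action of Prop. A8.1 Step 3, instantiated

Kernel annex of sub-claim A2 (seat p6, cell pub-hodge-repro2). `A2GaloisKernel` proves the
Galois-transitivity step of Prop. A8.1 Step 3 for an ABSTRACT family of semilinear bijections
`ρ_σ` commuting with an `L`-linear operator `T` («taken as data», LEAN-ANNEX-p6.md §3).  This
file supplies the data of the section: on `W = L ⊗[K] V` (in the section `K = ℚ`, `L = F₁`,
`V = H²(A_a × A_b, ℚ)`) the coefficient action `ρ_σ = σ ⊗ id` is `σ`-semilinear, `ρ_{σ⁻¹}`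
inverts it, it commutes with every base-changed operator `T = t ⊗ id`, and the base change
`λ ⊗ id : W → L` of a rational functional `λ : V → K` is `σ`-equivariant — so
`A2GaloisKernel.eq_zero_of_ker_stable` applies and gives the section's conclusion
(`eq_zero_of_baseChange_eigenspace_le_ker`): a rational functional whose base change kills ONE
eigenline `L_{μ₀}` of `T` kills all the conjugate eigenlines `L_{σ μ₀}`, hence is zero when
these span.  Linear algebra only; nothing geometric.
-/

namespace Summit.Ventures.HodgeRepro2.A2GaloisKernelInstance

open TensorProduct

variable {K L : Type*} [Field K] [Field L] [Algebra K L]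
  {V : Type*} [AddCommGroup V] [Module K V]

/-- The coefficient action `σ ⊗ id` on `L ⊗[K] V` as a `σ`-semilinear map of `L`-modules. -/
def coeffAct (σ : L ≃ₐ[K] L) : (L ⊗[K] V) →ₛₗ[(σ : L →+* L)] (L ⊗[K] V) where
  toFun := LinearMap.rTensor V σ.toLinearMap
  map_add' := map_add _
  map_smul' c x := by
    induction x using TensorProduct.induction_on with
    | zero => simp
    | tmul a v =>
      simp only [TensorProduct.smul_tmul', LinearMap.rTensor_tmul, AlgEquiv.toLinearMap_apply,
        smul_eq_mul, map_mul, RingHom.coe_coe]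
    | add x y hx hy => simp only [smul_add, map_add, hx, hy]

/-- `coeffAct` on a pure tensor. -/
theorem coeffAct_tmul (σ : L ≃ₐ[K] L) (c : L) (v : V) :
    coeffAct (V := V) σ (c ⊗ₜ[K] v) = σ c ⊗ₜ[K] v :=
  LinearMap.rTensor_tmul _ _ _ _

/-- `coeffAct` is the `K`-linear map `σ ⊗ id` (`LinearMap.rTensor`). -/
theorem coeffAct_apply (σ : L ≃ₐ[K] L) (x : L ⊗[K] V) :
    coeffAct σ x = LinearMap.rTensor V σ.toLinearMap x := rfl

/-- `σ⁻¹ ⊗ id` inverts `σ ⊗ id`. -/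
theorem coeffAct_symm_coeffAct (σ : L ≃ₐ[K] L) (x : L ⊗[K] V) :
    coeffAct σ (coeffAct σ.symm x) = x := by
  induction x using TensorProduct.induction_on with
  | zero => simp
  | tmul a v => rw [coeffAct_tmul, coeffAct_tmul, AlgEquiv.apply_symm_apply]
  | add x y hx hy => rw [map_add, map_add, hx, hy]

/-- The ring-hom identity `σ⁻¹ ∘ σ = id` in the form `A2GaloisKernel` asks for. -/
theorem coe_symm_apply_apply (σ : L ≃ₐ[K] L) (a : L) :
    (σ.symm : L →+* L) ((σ : L →+* L) a) = a :=
  σ.symm_apply_apply a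

/-- The coefficient action commutes with every base-changed operator `t ⊗ id`. -/
theorem coeffAct_baseChange (σ : L ≃ₐ[K] L) (t : V →ₗ[K] V) (x : L ⊗[K] V) :
    coeffAct σ (t.baseChange L x) = t.baseChange L (coeffAct σ x) := by
  induction x using TensorProduct.induction_on with
  | zero => simp
  | tmul a v => rw [LinearMap.baseChange_tmul, coeffAct_tmul, coeffAct_tmul,
      LinearMap.baseChange_tmul]
  | add x y hx hy => rw [map_add, map_add, hx, hy, map_add, map_add]

/-- The base change `λ ⊗ id : L ⊗[K] V → L` of a rational functional `λ : V → K`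
(`c ⊗ v ↦ λ(v) • c`). -/
def baseChangeFunctional (lam : V →ₗ[K] K) : (L ⊗[K] V) →ₗ[L] L :=
  (TensorProduct.AlgebraTensorModule.rid K L L).toLinearMap.comp (lam.baseChange L)

/-- `baseChangeFunctional` on a pure tensor. -/
theorem baseChangeFunctional_tmul (lam : V →ₗ[K] K) (c : L) (v : V) :
    baseChangeFunctional (L := L) lam (c ⊗ₜ[K] v) = lam v • c := by
  simp [baseChangeFunctional, LinearMap.baseChange_tmul, TensorProduct.AlgebraTensorModule.rid_tmul]

/-- `baseChangeFunctional` on a rational vector `1 ⊗ v` is `λ v` (in `L`). -/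
theorem baseChangeFunctional_one_tmul (lam : V →ₗ[K] K) (v : V) :
    baseChangeFunctional (L := L) lam ((1 : L) ⊗ₜ[K] v) = algebraMap K L (lam v) := by
  rw [baseChangeFunctional_tmul, Algebra.algebraMap_eq_smul_one]

/-- The base-changed functional is `σ`-equivariant: `(λ ⊗ id) ∘ (σ ⊗ id) = σ ∘ (λ ⊗ id)`
(its values on rational vectors lie in `K`, which `σ` fixes). -/
theorem baseChangeFunctional_coeffAct (σ : L ≃ₐ[K] L) (lam : V →ₗ[K] K) (x : L ⊗[K] V) :
    baseChangeFunctional lam (coeffAct σ x) = (σ : L →+* L) (baseChangeFunctional lam x) := by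
  induction x using TensorProduct.induction_on with
  | zero => simp
  | tmul a v =>
    rw [coeffAct_tmul, baseChangeFunctional_tmul, baseChangeFunctional_tmul, Algebra.smul_def,
      Algebra.smul_def, RingHom.coe_coe, map_mul, AlgEquiv.commutes]
  | add x y hx hy => rw [map_add, map_add, hx, hy, map_add, map_add]

/-- The kernel of the base-changed functional is stable under every `σ ⊗ id`. -/
theorem ker_baseChangeFunctional_stable (σ : L ≃ₐ[K] L) (lam : V →ₗ[K] K) :
    ∀ w ∈ LinearMap.ker (baseChangeFunctional (L := L) lam),
      coeffAct σ w ∈ LinearMap.ker (baseChangeFunctional (L := L) lam) :=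
  A2GaloisKernel.ker_stable_of_equivariant (coeffAct σ) (baseChangeFunctional lam)
    (baseChangeFunctional_coeffAct σ lam)

/-- **Prop. A8.1 Step 3, instantiated.** Let `t : V → V` be a rational operator and
`λ : V → K` a rational functional whose base change `λ ⊗ id` kills the `μ₀`-eigenspace of
`t ⊗ id` on `L ⊗[K] V`.  If the eigenspaces for the conjugates `σ μ₀`, `σ ∈ Gal(L/K)`, span
`L ⊗[K] V`, then `λ = 0`. -/
theorem eq_zero_of_baseChange_eigenspace_le_ker (t : V →ₗ[K] V) (lam : V →ₗ[K] K) (μ₀ : L)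
    (h0 : Module.End.eigenspace (t.baseChange L) μ₀ ≤
      LinearMap.ker (baseChangeFunctional (L := L) lam))
    (hspan : ⨆ σ : L ≃ₐ[K] L, Module.End.eigenspace (t.baseChange L) (σ μ₀) = ⊤) :
    lam = 0 := by
  have hL : baseChangeFunctional (L := L) lam = 0 :=
    A2GaloisKernel.eq_zero_of_ker_stable (ι := L ≃ₐ[K] L) (fun σ => (σ : L →+* L))
      (fun σ => (σ.symm : L →+* L)) (fun σ => coeffAct σ) (fun σ => coeffAct σ.symm)
      (fun σ a => coe_symm_apply_apply σ a) (fun σ x => coeffAct_symm_coeffAct σ x)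
      (t.baseChange L) (fun σ x => coeffAct_baseChange σ.symm t x)
      (baseChangeFunctional lam) (fun σ => ker_baseChangeFunctional_stable σ lam) μ₀ h0 hspan
  ext v
  simp only [LinearMap.zero_apply]
  have h1 := baseChangeFunctional_one_tmul (L := L) lam v
  rw [hL, LinearMap.zero_apply] at h1
  exact (algebraMap K L).injective (by rw [← h1, map_zero])

end Summit.Ventures.HodgeRepro2.A2GaloisKernelInstance
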